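import Summits.FinalStateConjecture.FinalStateConjecture.Theorems.EIHFluxBalanceInertialRecessionStubSlavingCOERSymbol
import Summits.FinalStateConjecture.FinalStateConjecture.Theorems.EIHFluxBalanceInertialRecessionStubSlavingCOERLieKernel
import Summits.FinalStateConjecture.FinalStateConjecture.Theorems.EIHFluxBalanceInertialRecessionSlavingSpatialRigidity
import Summits.FinalStateConjecture.FinalStateConjecture.Theorems.EIHFluxBalanceInertialRecessionStubSlaving3ZeroSet

/-!
# Route EIHFluxBalance — `InertialRecession` (E′), stub `stub_frozenVacuumSlaving`:
# the `J²`-block in the LAB frame — a second-jet change of the painted Schwarzschild summand along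
# `dx⁰ ⊗ dx⁰ ⊗ (first variation)` is seen by the Ricci rows, for EVERY boost

Helper file for the crux `stmt-FinalStateConjecture-17403`
(`Summit.FinalStateConjecture.FinalStateConjecture.Theses.EIHFluxBalance.InertialRecession`, E′),
stub `stub_frozenVacuumSlaving` (roadmap `FVS_momentum_roadmap.md`, step (P6)). Assembly of the
three landed parts of the all-boost coercivity programme — the principal-symbol slot and kernel
lemma (`…StubSlavingCOERSymbol`), the closed form and four-event rigidity of the Lie derivative of
the static Schwarzschild components (`…StubSlavingCOERLie`, `…StubSlavingCOERLieKernel`) — in the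
frame in which the slaving analysis reads them: the LAB frame of a boosted summand
`G₀ = boostedKerrBilin Λ c M 0`, slicing covector `ζ = dx⁰`.

* `bilin_nullVector_left`, `ell_nullVector`, `mu_nullVector_eq_zero` — Kerr–Schild raising
  `g(ℓ♯, ·) = ℓ`, `ℓ(ℓ♯) = 0`, and `μ(ℓ♯) = 0` for the covector `μ` of the null pair
  `𝓛_Z g = ℓ ⊗ μ + μ ⊗ ℓ` (`lieDeriv_bilin_zero_spin_eq`);
* `lieDeriv_skew_eq_nullPair` — for a general `η`-skew generator `Ω` (rotation part removed by
  `lieDeriv_bilin_zero_spin_rotation_eq_zero`) the first variation at an event is the null pair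
  `ℓ ⊗ μ + μ ⊗ ℓ` with `μ` built from `p = Ωe₀` and `V = ω_p y + q`;
* `sharpAt_boosted_ellLab` — in the lab frame `♯_{G₀(x)} (ℓ ∘ Λ⁻¹) = Λ ℓ♯`;
* `spatial_eq_zero_of_symbolRows_eq_zero_four_events` — **main**: if at four lab events `xₖ`
  (rest images off the time axis, spatial parts in general position) the principal-symbol
  expression `σ_{G₀(xₖ)}(dx⁰)` of the lab first-variation form
  `Varₖ(v,w) = [∂_{Ωyₖ+q} g + g(Ω·,·) + g(·,Ω·)](Λ⁻¹v, Λ⁻¹w)` vanishes (all rows), then `(Ωe₀)⃗ = 0`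
  and `q⃗ = 0`;
* `spatial_eq_zero_of_ricAt_eq_four_events` — **two-metric form** consumed by (P6): metric
  components `G, G'` on an open set containing the four events, with `G(xₖ) = G₀(xₖ)`, equal
  `1`-jets and `D²G'(xₖ)(v)(w) = D²G(xₖ)(v)(w) + v⁰ w⁰ Varₖ`; if `Ric(G') = Ric(G)` at the four events
  then `(Ωe₀)⃗ = 0` and `q⃗ = 0` (`ricAt_apply_eq_add_symbol_of_jets`).

Elementary; no definitions, no named facts, no `sorry`.
-/

set_option linter.dupNamespace false
set_option maxSynthPendingDepth 3

noncomputable section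

open Set Function Module Submodule Literature.Geometry.Lorentzian
  Literature.Geometry.Lorentzian.Schwarzschild Literature.Geometry.Lorentzian.MetricCoord
open scoped InnerProductSpace

namespace Summit.FinalStateConjecture.FinalStateConjecture.Theorems.SublinearIsFree.Slaving

/-! ### Kerr–Schild raising and the null vector at `a = 0` -/

section NullVector

/-- **Kerr–Schild raising**: `g_{M,a}(ℓ♯, w) = ℓ(w)` wherever `r > 0` (`η(ℓ♯,·) = ℓ` and `ℓ(ℓ♯) = 0`).
[cite: KerrSchild1965, §2] -/
theorem bilin_nullVector_left (M a : ℝ) {x : E4} (hx : 0 < Kerr.radius a x) (w : E4) :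
    Kerr.bilin M a x (Kerr.nullVector a x) w = Kerr.nullCovector a x w := by
  rw [Kerr.bilin_apply, Kerr.bilin_nullVector, Kerr.nullCovector_nullVector hx]
  ring

/-- The time component of `ℓ♯` at `a = 0`: `(ℓ♯)⁰ = −1`. [cite: KerrSchild1965, §2] -/
theorem nullVector_zero_spin_apply_zero (x : E4) : Kerr.nullVector 0 x 0 = -1 := by
  simp [Kerr.nullVector, Kerr.nullCovectorFun]

/-- The spatial part of `ℓ♯` at `a = 0`: `(ℓ♯)⃗ = x⃗ / r` off the time axis. [cite: KerrSchild1965, §2] -/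
theorem spatial_nullVector_zero_spin {x : E4} (hx : E4.spatial x ≠ 0) :
    E4.spatial (Kerr.nullVector 0 x) = (E4.spatialNorm x)⁻¹ • E4.spatial x := by
  have hr : E4.spatialNorm x ≠ 0 := by rwa [E4.spatialNorm, norm_ne_zero_iff]
  have hrad : Kerr.radius 0 x = E4.spatialNorm x := Kerr.radius_zero_left x
  ext i
  fin_cases i <;>
    simp [Kerr.nullVector, Kerr.nullCovectorFun, E4.spatial_apply, hrad, Fin.succ_zero_eq_one,
      Fin.succ_one_eq_two, show (2 : Fin 3).succ = (3 : Fin 4) from rfl] <;>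
    field_simp

/-- `ℓ(ℓ♯) = 0` at `a = 0`, in the atoms of `SchwarzschildKerrSchildComponents`. [cite: KerrSchild1965, §2] -/
theorem ell_nullVector {x : E4} (hx : E4.spatial x ≠ 0) : ell x (Kerr.nullVector 0 x) = 0 := by
  have hr : 0 < Kerr.radius 0 x := by
    rw [Kerr.radius_zero_left, E4.spatialNorm]; exact norm_pos_iff.2 hx
  rw [← nullCovector_zero_eq_ell, Kerr.nullCovector_nullVector hr]

/-- `⟪x⃗, (ℓ♯)⃗⟫ = r` at `a = 0`. [folklore] -/
theorem sdot_self_nullVector {x : E4} (hx : E4.spatial x ≠ 0) :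
    sdot x (Kerr.nullVector 0 x) = E4.spatialNorm x := by
  have hr : E4.spatialNorm x ≠ 0 := by rwa [E4.spatialNorm, norm_ne_zero_iff]
  rw [sdot, spatial_nullVector_zero_spin hx, inner_smul_right, real_inner_self_eq_norm_sq,
    ← E4.spatialNorm]
  field_simp

/-- `⟪v⃗, (ℓ♯)⃗⟫ = ⟪x⃗, v⃗⟫ / r` at `a = 0`. [folklore] -/
theorem sdot_nullVector {x : E4} (hx : E4.spatial x ≠ 0) (v : E4) :
    sdot v (Kerr.nullVector 0 x) = sdot x v / E4.spatialNorm x := by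
  rw [sdot, spatial_nullVector_zero_spin hx, inner_smul_right, sdot, real_inner_comm]
  ring

/-- **`μ(ℓ♯) = 0`** for the covector `μ` of the null pair `𝓛_Z g_{M,0} = ℓ ⊗ μ + μ ⊗ ℓ`
(`lieDeriv_bilin_zero_spin_eq`): `ℓ(ℓ♯) = 0`, `P(V, ℓ♯) = 0`, `⟪p⃗,(ℓ♯)⃗⟫ + (ℓ♯)⁰⟪x⃗,p⃗⟫/r = 0`.
[cite: KerrSchild1965, §2] -/
theorem mu_nullVector_eq_zero (M : ℝ) {x : E4} (hx : E4.spatial x ≠ 0) (p V : E4) :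
    -(M / E4.spatialNorm x ^ 3) * sdot x V * ell x (Kerr.nullVector 0 x)
      + 2 * M / E4.spatialNorm x * (proj x V (Kerr.nullVector 0 x) / E4.spatialNorm x)
      + 2 * M / E4.spatialNorm x * (sdot p (Kerr.nullVector 0 x)
        + Kerr.nullVector 0 x 0 * (sdot x p / E4.spatialNorm x)) = 0 := by
  have hr : E4.spatialNorm x ≠ 0 := by rwa [E4.spatialNorm, norm_ne_zero_iff]
  rw [ell_nullVector hx, proj, sdot_nullVector hx, sdot_self_nullVector hx, sdot_nullVector hx,
    nullVector_zero_spin_apply_zero]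
  field_simp
  ring

end NullVector

/-! ### The first variation under a general `η`-skew generator is a null pair -/

section NullPair

/-- **The first variation of `g_{M,0}` under an `η`-skew generator `Ω` and a translation `q` is the
null pair `ℓ ⊗ μ + μ ⊗ ℓ`**, with `μ` the covector of `lieDeriv_bilin_zero_spin_eq` for the boost
part `p = Ωe₀` and the direction `V = ω_p y + q` (the rotation part of `Ω` is Killing,
`lieDeriv_bilin_zero_spin_rotation_eq_zero`). [cite: KerrSchild1965, §2] -/
theorem lieDeriv_skew_eq_nullPair (M : ℝ) {Ω : E4 →L[ℝ] E4}
    (hΩ : ∀ A B, Minkowski.bilin (Ω A) B + Minkowski.bilin A (Ω B) = 0) (q : E4) {y : E4}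
    (hy : E4.spatial y ≠ 0) (A B : E4) :
    fderiv ℝ (Kerr.bilin M 0) y (Ω y + q) A B + Kerr.bilin M 0 y (Ω A) B + Kerr.bilin M 0 y A (Ω B) =
    ell y A * (-(M / E4.spatialNorm y ^ 3) * sdot y (E4.ofTimeSpace (sdot (Ω (E4.ofTimeSpace 1 0)) y)
          (y 0 • E4.spatial (Ω (E4.ofTimeSpace 1 0))) + q) * ell y B
        + 2 * M / E4.spatialNorm y * (proj y (E4.ofTimeSpace (sdot (Ω (E4.ofTimeSpace 1 0)) y)
          (y 0 • E4.spatial (Ω (E4.ofTimeSpace 1 0))) + q) B / E4.spatialNorm y)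
        + 2 * M / E4.spatialNorm y * (sdot (Ω (E4.ofTimeSpace 1 0)) B
          + B 0 * (sdot y (Ω (E4.ofTimeSpace 1 0)) / E4.spatialNorm y)))
    + (-(M / E4.spatialNorm y ^ 3) * sdot y (E4.ofTimeSpace (sdot (Ω (E4.ofTimeSpace 1 0)) y)
          (y 0 • E4.spatial (Ω (E4.ofTimeSpace 1 0))) + q) * ell y A
        + 2 * M / E4.spatialNorm y * (proj y (E4.ofTimeSpace (sdot (Ω (E4.ofTimeSpace 1 0)) y)
          (y 0 • E4.spatial (Ω (E4.ofTimeSpace 1 0))) + q) A / E4.spatialNorm y)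
        + 2 * M / E4.spatialNorm y * (sdot (Ω (E4.ofTimeSpace 1 0)) A
          + A 0 * (sdot y (Ω (E4.ofTimeSpace 1 0)) / E4.spatialNorm y))) * ell y B := by
  obtain ⟨hp0, hρ0, -, hρskew⟩ := skew_decomposition hΩ
  set p : E4 := Ω (E4.ofTimeSpace 1 0) with hp
  set ρ : E4 → E4 := fun A ↦ Ω A - E4.ofTimeSpace (sdot p A) (A 0 • E4.spatial p) with hρ
  have hsplit : ∀ A, Ω A = E4.ofTimeSpace (sdot p A) (A 0 • E4.spatial p) + ρ A := by
    intro A; simp only [hρ]; abel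
  have hrot := lieDeriv_bilin_zero_spin_rotation_eq_zero M hy (R := ρ) hρ0 hρskew A B
  have hmain := lieDeriv_bilin_zero_spin_eq M hy p
    (E4.ofTimeSpace (sdot p y) (y 0 • E4.spatial p) + q) A B
  rw [hsplit y, hsplit A, hsplit B]
  simp only [map_add, add_apply] at hmain ⊢
  linear_combination hmain + hrot

end NullPair

/-! ### Raising in the lab frame -/

section Lab

variable {Λ : lorentzGroup} {c : E4} {M : ℝ} {x : E4}

/-- The boosted summand gives metric components on the preimage of `{r > 0}`; in particular its
value at a lab point with rest image off the time axis is invertible. [cite: KerrSchild1965, §2] -/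
theorem isInvertible_boostedKerrBilin_zero_spin (hx : E4.spatial (poincareInv Λ c x) ≠ 0) :
    (boostedKerrBilin Λ c M 0 x).IsInvertible := by
  have hr : 0 < Kerr.radius 0 (poincareInv Λ c x) := by
    rw [Kerr.radius_zero_left, E4.spatialNorm]; exact norm_pos_iff.2 hx
  have hx' : x ∈ poincareInv Λ c ⁻¹' (Kerr.region (0 : ℝ) 0 : Set E4) := by
    show poincareInv Λ c x ∈ (Kerr.region (0 : ℝ) 0 : Set E4)
    rw [SetLike.mem_coe, Kerr.mem_region, max_self]
    exact hr
  have hmet := (isMetricOn_kerr_bilin M 0).isMetricOn_pullMetric (isCoordChangeOn_poincareInv Λ c 0)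
  rw [pullMetric_kerr_bilin_poincareInv] at hmet
  exact hmet.isInvertible x hx'

/-- **Lab raising of the boosted null covector**: `♯_{G₀(x)} (ℓ ∘ Λ⁻¹) = Λ ℓ♯`, where
`G₀ = boostedKerrBilin Λ c M 0`, `ℓ` the null covector at the rest image `y = Λ⁻¹(x − c)`.
[cite: KerrSchild1965, §2] -/
theorem sharpAt_boosted_ellLab (hx : E4.spatial (poincareInv Λ c x) ≠ 0) :
    sharpAt (boostedKerrBilin Λ c M 0) x
        ((Kerr.nullCovector 0 (poincareInv Λ c x)).comp (((Λ : E4 ≃L[ℝ] E4).symm : E4 →L[ℝ] E4))) =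
      ((Λ : E4 ≃L[ℝ] E4) : E4 →L[ℝ] E4) (Kerr.nullVector 0 (poincareInv Λ c x)) := by
  have hr : 0 < Kerr.radius 0 (poincareInv Λ c x) := by
    rw [Kerr.radius_zero_left, E4.spatialNorm]; exact norm_pos_iff.2 hx
  refine sharpAt_eq_of_forall (isInvertible_boostedKerrBilin_zero_spin hx) fun w ↦ ?_
  rw [boostedKerrBilin_apply, ContinuousLinearMap.comp_apply, ContinuousLinearEquiv.coe_coe,
    ContinuousLinearEquiv.coe_coe, ContinuousLinearEquiv.symm_apply_apply,
    bilin_nullVector_left M 0 hr]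

end Lab

/-! ### Main theorem: the symbol rows of the lab first-variation form at four events -/

section Main

variable {Λ : lorentzGroup} {c : E4} {M : ℝ}

/-- `dx⁰(v) = v⁰`. [folklore] -/
theorem dx_zero_apply (v : E4) : E4.dx 0 v = v 0 := rfl

/-- The boosted summand is symmetric. [cite: KerrSchild1965, §2] -/
theorem boostedKerrBilin_zero_spin_symm (Λ : lorentzGroup) (c : E4) (M : ℝ) (x v w : E4) :
    boostedKerrBilin Λ c M 0 x v w = boostedKerrBilin Λ c M 0 x w v := by
  rw [boostedKerrBilin_apply, boostedKerrBilin_apply, Kerr.bilin_symm]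

/-- **Main theorem ((P6), qualitative, lab frame).** Let `M ≠ 0`, `Λ ∈ O(1,3)`, `c ∈ E4`, `Ω` an
`η`-skew operator, `q ∈ E4`, and `x₀, …, x₃` lab events whose rest images `yₖ = Λ⁻¹(xₖ − c)` are off
the time axis with spatial parts in general position. Let `Varₖ` be the lab first-variation forms,
`Varₖ(v, w) = ∂_{Ωyₖ+q} g(A,B) + g(ΩA, B) + g(A, ΩB)`, `A = Λ⁻¹v`, `B = Λ⁻¹w`, `g = Kerr.bilin M 0` at `yₖ`,
and `G` any field with `G(xₖ) = boostedKerrBilin Λ c M 0 xₖ` (it fixes `♯` and `tr`). If for all `k, Y, Z`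
`dx⁰(Z) dx⁰(♯ Varₖ(·,Y)) + dx⁰(Y) Varₖ(♯dx⁰, Z) − dx⁰(♯dx⁰) Varₖ(Y,Z) − dx⁰(Y) dx⁰(Z) tr_G Varₖᵗ = 0`
(twice the principal-symbol term of `ricAt_apply_eq_add_symbol_of_jets`), then `(Ωe₀)⃗ = 0` and
`q⃗ = 0`. Per event: `Varₖ` is the lab null pair `(ℓ∘Λ⁻¹) ⊗ (μ∘Λ⁻¹) + …` (`lieDeriv_skew_eq_nullPair`),
`♯(ℓ∘Λ⁻¹) = Λℓ♯` (`sharpAt_boosted_ellLab`) has `dx⁰ ≠ 0` (`boostedNull_apply_zero_ne_zero`), and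
the kernel lemma `eq_zero_of_symbol_nullPair_row_eq_zero` gives `μ = 0`; then the four-event kernel
theorem `spatial_eq_zero_of_lieDeriv_skew_eq_zero_four_events`. [cite: KerrSchild1965, §2] -/
theorem spatial_eq_zero_of_symbolRows_eq_zero_four_events (hM : M ≠ 0) {Ω : E4 →L[ℝ] E4}
    (hΩ : ∀ A B, Minkowski.bilin (Ω A) B + Minkowski.bilin A (Ω B) = 0) (q : E4) (x : Fin 4 → E4)
    (hx : ∀ k, E4.spatial (poincareInv Λ c (x k)) ≠ 0)
    (hind : ∀ i j k : Fin 4, i ≠ j → j ≠ k → i ≠ k →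
      LinearIndependent ℝ ![E4.spatial (poincareInv Λ c (x i)), E4.spatial (poincareInv Λ c (x j)),
        E4.spatial (poincareInv Λ c (x k))])
    (Var : Fin 4 → E4 →L[ℝ] E4 →L[ℝ] ℝ)
    (hVar : ∀ k, ∀ v w : E4, Var k v w =
      fderiv ℝ (Kerr.bilin M 0) (poincareInv Λ c (x k)) (Ω (poincareInv Λ c (x k)) + q)
          ((((Λ : E4 ≃L[ℝ] E4).symm : E4 →L[ℝ] E4)) v) ((((Λ : E4 ≃L[ℝ] E4).symm : E4 →L[ℝ] E4)) w)
        + Kerr.bilin M 0 (poincareInv Λ c (x k)) (Ω ((((Λ : E4 ≃L[ℝ] E4).symm : E4 →L[ℝ] E4)) v))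
          ((((Λ : E4 ≃L[ℝ] E4).symm : E4 →L[ℝ] E4)) w)
        + Kerr.bilin M 0 (poincareInv Λ c (x k)) ((((Λ : E4 ≃L[ℝ] E4).symm : E4 →L[ℝ] E4)) v)
          (Ω ((((Λ : E4 ≃L[ℝ] E4).symm : E4 →L[ℝ] E4)) w)))
    (G : E4 → E4 →L[ℝ] E4 →L[ℝ] ℝ) (hG : ∀ k, G (x k) = boostedKerrBilin Λ c M 0 (x k))
    (h : ∀ k, ∀ Y Z : E4,
      E4.dx 0 Z * E4.dx 0 (sharpAt G (x k) ((Var k).flip Y))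
        + E4.dx 0 Y * Var k (sharpAt G (x k) (E4.dx 0)) Z
        - E4.dx 0 (sharpAt G (x k) (E4.dx 0)) * Var k Y Z
        - E4.dx 0 Y * E4.dx 0 Z * mtrAt G (x k) (Var k).flip = 0) :
    E4.spatial (Ω (E4.ofTimeSpace 1 0)) = 0 ∧ E4.spatial q = 0 := by
  refine spatial_eq_zero_of_lieDeriv_skew_eq_zero_four_events hM hΩ q
    (fun k ↦ poincareInv Λ c (x k)) hx hind (fun k A B ↦ ?_)
  -- notation for the event `k`
  set y : E4 := poincareInv Λ c (x k) with hy
  set Li : E4 →L[ℝ] E4 := (((Λ : E4 ≃L[ℝ] E4).symm : E4 →L[ℝ] E4)) with hLi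
  set L : E4 →L[ℝ] E4 := ((Λ : E4 ≃L[ℝ] E4) : E4 →L[ℝ] E4) with hL
  set p : E4 := Ω (E4.ofTimeSpace 1 0) with hp
  set V : E4 := E4.ofTimeSpace (sdot p y) (y 0 • E4.spatial p) + q with hV
  set r : ℝ := E4.spatialNorm y with hr
  have hyk : E4.spatial y ≠ 0 := hx k
  have hr0 : r ≠ 0 := by rw [hr, E4.spatialNorm, norm_ne_zero_iff]; exact hyk
  have hrad : 0 < Kerr.radius 0 y := by
    rw [Kerr.radius_zero_left, E4.spatialNorm]; exact norm_pos_iff.2 hyk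
  -- the covector `μ` of the null pair, as a continuous linear map
  set μ : E4 →L[ℝ] ℝ := (-(M / r ^ 3) * sdot y V) • Kerr.nullCovector 0 y
      + (2 * M / r * r⁻¹) • (sdotCLM V - (sdot y V / r ^ 2) • sdotCLM y)
      + (2 * M / r) • (sdotCLM p + (sdot y p / r) • E4.dx 0) with hμ
  have hμapply : ∀ B : E4, μ B = -(M / r ^ 3) * sdot y V * ell y B
      + 2 * M / r * (proj y V B / r) + 2 * M / r * (sdot p B + B 0 * (sdot y p / r)) := by
    intro B
    simp only [hμ, add_apply, FunLike.coe_smul, Pi.smul_apply, sub_apply, sdotCLM_apply, smul_eq_mul,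
      nullCovector_zero_eq_ell, proj, dx_zero_apply, hr]
    ring
  -- the lab covectors
  set ℓlab : E4 →L[ℝ] ℝ := (Kerr.nullCovector 0 y).comp Li with hℓlab
  set μlab : E4 →L[ℝ] ℝ := μ.comp Li with hμlab
  -- the variation form is the lab null pair
  have hpair : ∀ v w : E4, Var k v w = ℓlab v * μlab w + μlab v * ℓlab w := by
    intro v w
    rw [hVar k v w, lieDeriv_skew_eq_nullPair M hΩ q hyk, ← hp, ← hV, ← hr, ← hμapply, ← hμapply]
    simp only [hℓlab, hμlab, ContinuousLinearMap.comp_apply, nullCovector_zero_eq_ell]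
  -- raising
  set S := sharpAt G (x k) with hS
  have hS' : S = sharpAt (boostedKerrBilin Λ c M 0) (x k) := by
    rw [hS]; exact sharpAt_eq_of_apply_eq (hG k)
  have hSℓ : S ℓlab = L (Kerr.nullVector 0 y) := by
    rw [hS', hℓlab, hLi, hy, hL]; exact sharpAt_boosted_ellLab (hx k)
  have hinv : (G (x k)).IsInvertible := by
    rw [hG k]; exact isInvertible_boostedKerrBilin_zero_spin (hx k)
  have hsymm : ∀ v w : E4, G (x k) v w = G (x k) w v := by
    intro v w; rw [hG k]; exact boostedKerrBilin_zero_spin_symm Λ c M (x k) v w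
  -- the four scalar facts
  have hℓℓ : ℓlab (S ℓlab) = 0 := by
    rw [hSℓ, hℓlab, ContinuousLinearMap.comp_apply, hLi, hL, ContinuousLinearEquiv.coe_coe,
      ContinuousLinearEquiv.coe_coe, ContinuousLinearEquiv.symm_apply_apply,
      Kerr.nullCovector_nullVector hrad]
  have hmℓ : μlab (S ℓlab) = 0 := by
    rw [hSℓ, hμlab, ContinuousLinearMap.comp_apply, hLi, hL, ContinuousLinearEquiv.coe_coe,
      ContinuousLinearEquiv.coe_coe, ContinuousLinearEquiv.symm_apply_apply, hμapply]
    exact mu_nullVector_eq_zero M hyk p V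
  have hζℓ : E4.dx 0 (S ℓlab) ≠ 0 := by
    rw [hSℓ, dx_zero_apply, hL, hy]
    exact boostedNull_apply_zero_ne_zero Λ c 0 (x k) hrad
  have hℓζ : ℓlab (S (E4.dx 0)) ≠ 0 := by
    have h1 : ℓlab (S (E4.dx 0)) = E4.dx 0 (S ℓlab) := by
      rw [← apply_sharpAt_apply hinv ℓlab (S (E4.dx 0)), hsymm, apply_sharpAt_apply hinv]
    rw [h1]; exact hζℓ
  -- the row `Y = S ℓlab` of the hypothesis
  have hrow : ∀ Z : E4, E4.dx 0 (S ℓlab) * (ℓlab (S (E4.dx 0)) * μlab Z + μlab (S (E4.dx 0)) * ℓlab Z)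
      - mtrAt G (x k) (Var k).flip * (E4.dx 0 (S ℓlab) * E4.dx 0 Z) = 0 := by
    intro Z
    have h1 := h k (S ℓlab) Z
    have hflip : (Var k).flip (S ℓlab) = 0 := by
      ext w
      rw [ContinuousLinearMap.flip_apply, hpair, hℓℓ, hmℓ, mul_zero, mul_zero, add_zero,
        zero_apply]
    rw [hflip, map_zero, map_zero, mul_zero, zero_add, hpair (S ℓlab) Z, hℓℓ, hmℓ, zero_mul, zero_mul,
      add_zero, mul_zero, sub_zero, hpair] at h1
    linear_combination h1
  have hμ0 : μlab = 0 :=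
    eq_zero_of_symbol_nullPair_row_eq_zero S (E4.dx 0) ℓlab μlab (mtrAt G (x k) (Var k).flip)
      hℓℓ hmℓ hζℓ hℓζ hrow
  -- hence `μ = 0` and the rest-frame Lie derivative vanishes at `yₖ`
  have hμzero : ∀ B : E4, μ B = 0 := by
    intro B
    have h1 : μlab (L B) = 0 := by rw [hμ0]; rfl
    rwa [hμlab, ContinuousLinearMap.comp_apply, hLi, hL, ContinuousLinearEquiv.coe_coe,
      ContinuousLinearEquiv.coe_coe, ContinuousLinearEquiv.symm_apply_apply] at h1
  rw [lieDeriv_skew_eq_nullPair M hΩ q hyk, ← hp, ← hV, ← hr, ← hμapply, ← hμapply, hμzero A,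
    hμzero B, mul_zero, zero_mul, add_zero]

end Main

/-! ### Two-metric form: equal Ricci rows at four events force a trivial second-jet change -/

section TwoMetric

variable {Λ : lorentzGroup} {c : E4} {M : ℝ}

/-- **(P6) two-metric form.** Let `G, G'` be metric components on an open set containing four lab
events `xₖ` (rest images off the time axis, spatial parts in general position), with
`G(xₖ) = boostedKerrBilin Λ c M 0 xₖ`, equal `1`-jets at each `xₖ`, and second jets differing by
`D²G'(xₖ)(v)(w) = D²G(xₖ)(v)(w) + v⁰ w⁰ Varₖ`, where `Varₖ` is the lab first-variation form of the
painted Schwarzschild summand under an `η`-skew generator `Ω` and a translation `q` (as in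
`spatial_eq_zero_of_symbolRows_eq_zero_four_events`; two painted metrics with the same first-order
jets and different second-order jets are of this form). If `Ric(G') = Ric(G)` at the four events,
then `(Ωe₀)⃗ = 0` and `q⃗ = 0` (`ricAt_apply_eq_add_symbol_of_jets` and the main theorem): the
Ricci tensor at four general lab points sees the second-order jets `(ü^⊥, δ̇)` of a painted
Schwarzschild summand, for every boost. [cite: KerrSchild1965, §2] -/
theorem spatial_eq_zero_of_ricAt_eq_four_events (hM : M ≠ 0) {Ω : E4 →L[ℝ] E4}
    (hΩ : ∀ A B, Minkowski.bilin (Ω A) B + Minkowski.bilin A (Ω B) = 0) (q : E4) (x : Fin 4 → E4)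
    (hx : ∀ k, E4.spatial (poincareInv Λ c (x k)) ≠ 0)
    (hind : ∀ i j k : Fin 4, i ≠ j → j ≠ k → i ≠ k →
      LinearIndependent ℝ ![E4.spatial (poincareInv Λ c (x i)), E4.spatial (poincareInv Λ c (x j)),
        E4.spatial (poincareInv Λ c (x k))])
    (Var : Fin 4 → E4 →L[ℝ] E4 →L[ℝ] ℝ)
    (hVar : ∀ k, ∀ v w : E4, Var k v w =
      fderiv ℝ (Kerr.bilin M 0) (poincareInv Λ c (x k)) (Ω (poincareInv Λ c (x k)) + q)
          ((((Λ : E4 ≃L[ℝ] E4).symm : E4 →L[ℝ] E4)) v) ((((Λ : E4 ≃L[ℝ] E4).symm : E4 →L[ℝ] E4)) w)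
        + Kerr.bilin M 0 (poincareInv Λ c (x k)) (Ω ((((Λ : E4 ≃L[ℝ] E4).symm : E4 →L[ℝ] E4)) v))
          ((((Λ : E4 ≃L[ℝ] E4).symm : E4 →L[ℝ] E4)) w)
        + Kerr.bilin M 0 (poincareInv Λ c (x k)) ((((Λ : E4 ≃L[ℝ] E4).symm : E4 →L[ℝ] E4)) v)
          (Ω ((((Λ : E4 ≃L[ℝ] E4).symm : E4 →L[ℝ] E4)) w)))
    {G G' : E4 → E4 →L[ℝ] E4 →L[ℝ] ℝ} {W : Set E4} (hGm : IsMetricOn G W) (hG'm : IsMetricOn G' W)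
    (hxW : ∀ k, x k ∈ W) (hG : ∀ k, G (x k) = boostedKerrBilin Λ c M 0 (x k))
    (h0 : ∀ k, G' (x k) = G (x k)) (h1 : ∀ k, fderiv ℝ G' (x k) = fderiv ℝ G (x k))
    (h2 : ∀ k, ∀ v, fderiv ℝ (fderiv ℝ G') (x k) v =
      fderiv ℝ (fderiv ℝ G) (x k) v + E4.dx 0 v • (E4.dx 0).smulRight (Var k))
    (hric : ∀ k, ∀ Y Z : E4, ricAt G' (x k) Y Z = ricAt G (x k) Y Z) :
    E4.spatial (Ω (E4.ofTimeSpace 1 0)) = 0 ∧ E4.spatial q = 0 := by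
  refine spatial_eq_zero_of_symbolRows_eq_zero_four_events hM hΩ q x hx hind Var hVar G hG
    (fun k Y Z ↦ ?_)
  have h := ricAt_apply_eq_add_symbol_of_jets hGm hG'm (hxW k) (h0 k) (h1 k) (h2 k) Y Z
  rw [hric k Y Z] at h
  linear_combination (-2 : ℝ) * h

end TwoMetric

/-- **Registered one-line carrier form** (`coer_ricAt_four_event_rigidity_lab_s0`) of
`spatial_eq_zero_of_ricAt_eq_four_events`. [cite: KerrSchild1965, §2] -/
theorem coer_ricAt_four_event_rigidity_lab_s0 : open Literature.Geometry.Lorentzian in ∀ {Λ : lorentzGroup} {c : E4} {M : ℝ}, M ≠ 0 → ∀ {Ω : E4 →L[ℝ] E4}, (∀ A B, Minkowski.bilin (Ω A) B + Minkowski.bilin A (Ω B) = 0) → ∀ (q : E4) (x : Fin 4 → E4), (∀ k, E4.spatial (poincareInv Λ c (x k)) ≠ 0) → (∀ i j k : Fin 4, i ≠ j → j ≠ k → i ≠ k → LinearIndependent ℝ ![E4.spatial (poincareInv Λ c (x i)), E4.spatial (poincareInv Λ c (x j)), E4.spatial (poincareInv Λ c (x k))]) → ∀ (Var : Fin 4 →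 E4 →L[ℝ] E4 →L[ℝ] ℝ), (∀ k, ∀ v w : E4, Var k v w = fderiv ℝ (Kerr.bilin M 0) (poincareInv Λ c (x k)) (Ω (poincareInv Λ c (x k)) + q) ((((Λ : E4 ≃L[ℝ] E4).symm : E4 →L[ℝ] E4)) v) ((((Λ : E4 ≃L[ℝ] E4).symm : E4 →L[ℝ] E4)) w) + Kerr.bilin M 0 (poincareInv Λ c (x k)) (Ω ((((Λ : E4 ≃L[ℝ] E4).symm : E4 →L[ℝ] E4)) v)) ((((Λ : E4 ≃L[ℝ] E4).symm : E4 →L[ℝ] E4)) w) + Kerr.bilin M 0 (poincareInv Λ c (x k)) ((((Λ : E4 ≃L[ℝ] E4).symm : E4 →L[ℝ] E4)) v) (Ω ((((Λ : E4 ≃L[ℝ] E4).symm : E4 →L[ℝ] E4)) w))) → ∀ {G G' : E4 → E4 →L[ℝ] E4 →L[ℝ] ℝ} {W : Set E4}, MetricCoord.IsMetricOn G W → MetricCoord.IsMetricOn G' W → (∀ k, x k ∈ W) → (∀ k, G (x k) = boostedKerrBilin Λ c M 0 (x k)) → (∀ k, G' (x k) = G (x k)) → (∀ k, fderiv ℝ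 G' (x k) = fderiv ℝ G (x k)) → (∀ k, ∀ v, fderiv ℝ (fderiv ℝ G') (x k) v = fderiv ℝ (fderiv ℝ G) (x k) v + E4.dx 0 v • (E4.dx 0).smulRight (Var k)) → (∀ k, ∀ Y Z : E4, MetricCoord.ricAt G' (x k) Y Z = MetricCoord.ricAt G (x k) Y Z) → E4.spatial (Ω (E4.ofTimeSpace 1 0)) = 0 ∧ E4.spatial q = 0 :=
  fun hM _ hΩ q x hx hind Var hVar _ _ _ hGm hG'm hxW hG h0 h1 h2 hric ↦
    spatial_eq_zero_of_ricAt_eq_four_events hM hΩ q x hx hind Var hVar hGm hG'm hxW hG h0 h1 h2 hric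

end Summit.FinalStateConjecture.FinalStateConjecture.Theorems.SublinearIsFree.Slaving
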